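import Literature.NumberTheory.DiophantineGeometry.FaltingsHeight
import Literature.NumberTheory.EllipticCurves.SilvermanHeightLogDiscriminantProofs
import HarnessLib

/-!
# Proof of Pasten 2024, Lemma 18.1: `[L:ℚ]⁻¹ log N(𝔇_min(E/L)) < 12 h(E/L) + 16`

Topic `NumberTheory/DiophantineGeometry`; sibling PROOFS file of `FaltingsHeight.lean`, discharging
its named fact `WeierstrassCurve.log_minimalDiscriminantNorm_lt_faltingsHeight` (D-0014:
`theorem …_holds : …`), with no new definition and no new named fact.

**Source (held, read).** H. Pasten, *Shimura curves and the abc conjecture*, J. Number Theory 254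
(2024) 214–335 = arXiv:1705.09251, §18.1: Silverman's formula (EqSilvermanH)
`h(E) = (12[L:ℚ])⁻¹ (log Δ_E − Σ_{σ : L → ℂ} log|Δ(τ_{E,σ}) Im(τ_{E,σ})⁶|) − log(2π)` with
`Δ(z) = q ∏_{n≥1}(1 − qⁿ)²⁴`, from which "one deduces" **Lemma 18.1**:
`[L:ℚ]⁻¹ log Δ_E < 12 h(E) + 16` (`Δ_E` the norm of the minimal discriminant ideal of `E/L`).

**The printed deduction, formalised.** With the tree's closed formula
`12 [L:ℚ] h(E/L) = log N(𝔇_min) − Σ_σ faltingsArchTerm (E ⊗_σ ℂ)` (`WeierstrassCurve.faltingsHeight`,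
Silverman 1986 Prop. 1.1), Lemma 18.1 is *equivalent* to
`Σ_{σ : L → ℂ} faltingsArchTerm (E ⊗_σ ℂ) < 16 · [L:ℚ]`, and since there are exactly `[L:ℚ]`
embeddings (Mathlib `NumberField.Embeddings.card`) it suffices that every single archimedean term
is `< 16`, i.e. that for every elliptic curve `V/ℂ` with period lattice `Λ`
(`g₂(Λ) = c₄/12`, `g₃(Λ) = c₆/216`, so `g₂³ − 27g₃² = Δ_V`):
`log|Δ_V| + 6 log covol(Λ) < 16`, i.e. `|g₂³ − 27 g₃²|(Λ) · covol(Λ)⁶ < e¹⁶`. Writing `Λ = cΛ_τ`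
this is `(2π)¹² |Δ(τ)| Im(τ)⁶ < e¹⁶` on `ℍ`, the boundedness of the `SL₂(ℤ)`-invariant
`|Δ(τ)|Im(τ)⁶` made explicit on the standard fundamental domain via `Δ = q∏(1 − qⁿ)²⁴` — exactly
Pasten's summand `log|Δ(τ_σ) Im(τ_σ)⁶| + 12 log(2π) < 16`. The tree already proves the non-strict
bound `≤ e¹⁶` for every lattice
(`Literature.NumberTheory.EllipticCurves.ModularForms.norm_discr_mul_covolume_pow_six_le`, file
`SilvermanHeightLogDiscriminantProofs`); Lemma 18.1 is printed with `<`, so Steps 2–4 of that file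
are re-run here with the final numerical comparison `2.7182818283²² e⁻⁶ < e²² e⁻⁶` kept strict
(numerically the supremum is `≈ e^{15.85}`, attained at `τ = ρ`). Mathlib/tree ingredients:
`ModularForm.discriminant = η²⁴`, `ModularGroup.exists_smul_mem_fd`,
`three_le_four_mul_im_sq_of_mem_fd`, the Petersson invariance
`norm_discriminant_mul_im_pow_six_smul`, `PeriodPair.exists_lattice_eq_mulLeft_ofUpperHalfPlane`,
`PeriodPair.discr_ofUpperHalfPlane`, the uniformisation theorem
(`WeierstrassCurve.exists_periodPair_of_isElliptic'`) and the independence of `complexPeriod` from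
the chosen lattice (`complexPeriod_eq_two_mul_covolume'`).

## Contents

* `two_pi_pow_twelve_mul_lt_exp_sixteen` — the strict numerics on `3 ≤ 4y²`.
* `two_pi_pow_mul_norm_discriminant_mul_im_pow_six_lt` — `(2π)¹²|Δ(τ)|Im(τ)⁶ < e¹⁶` on `ℍ`.
* `norm_discr_mul_covolume_pow_six_lt` — `|g₂³ − 27g₃²| covol⁶ < e¹⁶` for every period pair.
* `WeierstrassCurve.faltingsArchTerm_lt_sixteen` — `log|Δ_V| + 6 log((i/2)∫ω∧ω̄) < 16` for
  elliptic `V/ℂ` (Pasten's summand bound).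
* `WeierstrassCurve.sum_faltingsArchTerm_lt` — `Σ_σ faltingsArchTerm (W ⊗_σ ℂ) < 16 [L:ℚ]`.
* `WeierstrassCurve.log_minimalDiscriminantNorm_lt_faltingsHeight_holds` — the discharge.

## References

* H. Pasten, *Shimura curves and the abc conjecture*, J. Number Theory 254 (2024) 214–335,
  arXiv:1705.09251: §18.1, formula (EqSilvermanH) and Lemma 18.1. [`PastenShimura2024`]
* J. H. Silverman, *Heights and elliptic curves*, in Arithmetic Geometry (Cornell–Silverman eds.),
  Springer (1986) 253–265: Prop. 1.1, Remark 1.2. [`Silverman1986`]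
-/

noncomputable section

open scoped Classical

namespace Literature.NumberTheory.DiophantineGeometry

open Complex UpperHalfPlane Literature.NumberTheory.EllipticCurves.ModularForms
open scoped Real MatrixGroups Modular

/-! ### Strict numerics on the fundamental domain -/

/-- **The numerical inequality, strict form**: for `3 ≤ 4y²`, `y > 0`,
`(2π)¹² · e^{-2πy} · exp(24r/(1-r)) · y⁶ < e¹⁶` with `r = e^{-2πy}`
(`≤ 2¹²3⁶π⁶e⁻⁶ · (1 + 24/199 + (24/199)²) ≤ 2.7182818283²² e⁻⁶ < e¹⁶`; the tree's
`two_pi_pow_twelve_mul_le_exp_sixteen` with the last comparison kept strict). [folklore] -/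
theorem two_pi_pow_twelve_mul_lt_exp_sixteen {y : ℝ} (hy0 : 0 < y) (hy : 3 ≤ 4 * y ^ 2) :
    (2 * π) ^ 12 * (Real.exp (-(2 * π * y)) *
      Real.exp (24 * (Real.exp (-(2 * π * y)) / (1 - Real.exp (-(2 * π * y)))))) * y ^ 6 <
      Real.exp 16 := by
  set r := Real.exp (-(2 * π * y)) with hr
  have hr0 : 0 < r := Real.exp_pos _
  have hr1 : r ≤ 1 / 200 := exp_neg_two_pi_mul_le_inv_two_hundred hy0 hy
  have h1r : 0 < 1 - r := by linarith
  set s := 24 * (r / (1 - r)) with hs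
  have hs0 : 0 ≤ s := by positivity
  have hs1 : s ≤ 24 / 199 := by
    have : r / (1 - r) ≤ 1 / 199 := by
      rw [div_le_div_iff₀ h1r (by norm_num)]
      linarith
    linarith
  have hexp_s : Real.exp s ≤ 1 + 24 / 199 + (24 / 199) ^ 2 := by
    have h := Real.abs_exp_sub_one_sub_id_le (x := s) (by rw [abs_of_nonneg hs0]; linarith)
    have h' := (abs_le.mp h).2
    nlinarith [hs0, hs1]
  have hmain := pow_six_mul_exp_neg_two_pi_mul_le hy0.le
  have hπ := Real.pi_lt_d4
  have hπ0 := Real.pi_pos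
  have he := Real.exp_one_gt_d9
  calc (2 * π) ^ 12 * (r * Real.exp s) * y ^ 6
        = (2 * π) ^ 12 * Real.exp s * (y ^ 6 * r) := by ring
    _ ≤ (2 * π) ^ 12 * (1 + 24 / 199 + (24 / 199) ^ 2) * ((3 / π) ^ 6 * Real.exp (-6)) := by
        gcongr
    _ = 2985984 * π ^ 6 * (1 + 24 / 199 + (24 / 199) ^ 2) * Real.exp (-6) := by
        field_simp
        ring
    _ ≤ 2985984 * 3.1416 ^ 6 * (1 + 24 / 199 + (24 / 199) ^ 2) * Real.exp (-6) := by gcongr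
    _ ≤ 2.7182818283 ^ 22 * Real.exp (-6) :=
        mul_le_mul_of_nonneg_right (by norm_num) (Real.exp_nonneg _)
    _ < Real.exp 1 ^ 22 * Real.exp (-6) :=
        mul_lt_mul_of_pos_right (pow_lt_pow_left₀ he (by norm_num) (by norm_num))
          (Real.exp_pos _)
    _ = Real.exp 16 := by rw [← Real.exp_nat_mul, ← Real.exp_add]; norm_num

/-! ### `(2π)¹² |Δ(τ)| (Im τ)⁶ < e¹⁶` on `ℍ` and `|g₂³ − 27g₃²| covol⁶ < e¹⁶` for every lattice -/

/-- **`(2π)¹² |Δ(τ)| (Im τ)⁶ < e¹⁶` on all of `ℍ`**: move `τ` into the standard fundamental domain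
(`ModularGroup.exists_smul_mem_fd`; `|Δ(γτ)|Im(γτ)⁶ = |Δ(τ)|Im(τ)⁶`, the tree's
`norm_discriminant_mul_im_pow_six_smul`), where `Im τ ≥ √3/2`, and apply the `η`-product bound
(`norm_discriminant_le_exp_mul_exp`) and the strict numerics. This is Pasten's summand bound
`log|Δ(τ)Im(τ)⁶| + 12 log(2π) < 16`. [cite: PastenShimura2024, §18.1 Lemma 18.1 (proof: "one deduces")] -/
theorem two_pi_pow_mul_norm_discriminant_mul_im_pow_six_lt (τ : ℍ) :
    (2 * π) ^ 12 * ‖ModularForm.discriminant τ‖ * τ.im ^ 6 < Real.exp 16 := by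
  obtain ⟨γ, hγ⟩ := ModularGroup.exists_smul_mem_fd τ
  rw [mul_assoc, ← norm_discriminant_mul_im_pow_six_smul γ τ, ← mul_assoc]
  have him : 3 ≤ 4 * (γ • τ).im ^ 2 := ModularGroup.three_le_four_mul_im_sq_of_mem_fd hγ
  calc (2 * π) ^ 12 * ‖ModularForm.discriminant (γ • τ)‖ * (γ • τ).im ^ 6
      ≤ (2 * π) ^ 12 * (Real.exp (-(2 * π * (γ • τ).im)) *
          Real.exp (24 * (Real.exp (-(2 * π * (γ • τ).im)) /
            (1 - Real.exp (-(2 * π * (γ • τ).im)))))) * (γ • τ).im ^ 6 := by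
        gcongr
        exact norm_discriminant_le_exp_mul_exp _
    _ < Real.exp 16 := two_pi_pow_twelve_mul_lt_exp_sixteen (γ • τ).im_pos him

open PeriodPair in
/-- **`|Δ(Λ)| · covol(Λ)⁶ < e¹⁶` for every lattice `Λ ⊂ ℂ`**, `Δ(Λ) = g₂(Λ)³ − 27g₃(Λ)²`:
`Λ = cΛ_τ` (`exists_lattice_eq_mulLeft_ofUpperHalfPlane`), `Δ(cΛ_τ) = c⁻¹²(2π)¹²Δ(τ)`
(`discr_mulLeft`, `discr_ofUpperHalfPlane`), `covol(cΛ_τ) = |c|² Im τ` (`covolume_mulLeft_lattice`,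
`covolume_ofUpperHalfPlane_lattice`), so the product is `(2π)¹²|Δ(τ)|(Im τ)⁶ < e¹⁶`. Strict form
of the tree's `norm_discr_mul_covolume_pow_six_le`. [folklore] -/
theorem norm_discr_mul_covolume_pow_six_lt (L : PeriodPair) :
    ‖L.g₂ ^ 3 - 27 * L.g₃ ^ 2‖ * ZLattice.covolume L.lattice ^ 6 < Real.exp 16 := by
  obtain ⟨τ, c, hc, h⟩ := L.exists_lattice_eq_mulLeft_ofUpperHalfPlane
  rw [g₂_eq_of_lattice_eq h, g₃_eq_of_lattice_eq h, discr_mulLeft, discr_ofUpperHalfPlane]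
  have hcov : ZLattice.covolume L.lattice = ‖c‖ ^ 2 * τ.im := by
    rw [← covolume_ofUpperHalfPlane_lattice τ, ← covolume_mulLeft_lattice _ c hc]
    simp only [h]
  have hc' : ‖c‖ ≠ 0 := norm_ne_zero_iff.mpr hc
  rw [hcov, norm_mul, norm_inv, norm_pow, norm_mul, norm_pow, norm_mul, Complex.norm_real,
    Real.norm_of_nonneg Real.pi_pos.le, Complex.norm_ofNat]
  calc (‖c‖ ^ 12)⁻¹ * ((2 * π) ^ 12 * ‖ModularForm.discriminant τ‖) * (‖c‖ ^ 2 * τ.im) ^ 6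
      = (2 * π) ^ 12 * ‖ModularForm.discriminant τ‖ * τ.im ^ 6 := by field_simp
    _ < Real.exp 16 := two_pi_pow_mul_norm_discriminant_mul_im_pow_six_lt τ

end Literature.NumberTheory.DiophantineGeometry

/-! ### The archimedean term of an elliptic curve over `ℂ` and the discharge -/

namespace WeierstrassCurve

open NumberField Literature.NumberTheory.DiophantineGeometry

/-- **Pasten's summand bound: `log|Δ_V| + 6 log((i/2)∫_{E(ℂ)} ω_V ∧ ω̄_V) < 16`** for every elliptic
curve `V/ℂ`, i.e. `faltingsArchTerm V < 16`. With a period lattice `Λ` of `ω_V`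
(`g₂(Λ) = c₄/12`, `g₃(Λ) = c₆/216`, which exists by uniformisation,
`exists_periodPair_of_isElliptic'`) one has `(i/2)∫ ω ∧ ω̄ = complexPeriod/2 = covol(Λ)`
(`complexPeriod_eq_two_mul_covolume'`) and `g₂³ − 27g₃² = Δ_V` (`c₄_div_cube_sub_eq_Δ`), so this is
`|g₂³ − 27g₃²|(Λ) covol(Λ)⁶ < e¹⁶` (`norm_discr_mul_covolume_pow_six_lt`) after taking logarithms —
in Pasten's notation `log|Δ(τ_σ) Im(τ_σ)⁶| + 12 log(2π) < 16`. (Dot-notation extension of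
Mathlib's `WeierstrassCurve`.) [cite: PastenShimura2024, §18.1 Lemma 18.1 (proof, via (EqSilvermanH))] -/
theorem faltingsArchTerm_lt_sixteen (V : WeierstrassCurve ℂ) [V.IsElliptic] :
    V.faltingsArchTerm < 16 := by
  obtain ⟨L, h₂, h₃⟩ := V.exists_periodPair_of_isElliptic'
  have hcov : 0 < ZLattice.covolume L.lattice := ZLattice.covolume_pos L.lattice _
  have hΔ : V.Δ ≠ 0 := V.isUnit_Δ.ne_zero
  have hnΔ : 0 < ‖V.Δ‖ := norm_pos_iff.mpr hΔ
  have hdisc : L.g₂ ^ 3 - 27 * L.g₃ ^ 2 = V.Δ := by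
    rw [h₂, h₃]
    exact V.c₄_div_cube_sub_eq_Δ
  have key := norm_discr_mul_covolume_pow_six_lt L
  rw [hdisc] at key
  have h2 : Real.log (‖V.Δ‖ * ZLattice.covolume L.lattice ^ 6) < 16 :=
    (Real.log_lt_iff_lt_exp (mul_pos hnΔ (pow_pos hcov 6))).2 key
  rw [Real.log_mul hnΔ.ne' (pow_ne_zero 6 hcov.ne'), Real.log_pow] at h2
  rw [faltingsArchTerm, V.complexPeriod_eq_two_mul_covolume' h₂ h₃,
    mul_div_cancel_left₀ _ (two_ne_zero)]
  push_cast at h2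
  linarith

section NumberField

variable {K : Type*} [Field K] [NumberField K] (W : WeierstrassCurve K)

/-- **The sum of the archimedean terms over the embeddings**: for an elliptic curve over a number
field `K` with model `W`, `Σ_{σ : K → ℂ} faltingsArchTerm (W ⊗_σ ℂ) < 16 · [K:ℚ]`, since each of the
`[K:ℚ]` summands (Mathlib `NumberField.Embeddings.card`) is `< 16` (`faltingsArchTerm_lt_sixteen`).
This is the sum `Σ_σ (log|Δ(τ_{E,σ}) Im(τ_{E,σ})⁶| + 12 log(2π)) < 16 [L:ℚ]` of Pasten's deduction.
(Dot-notation extension of Mathlib's `WeierstrassCurve`.) [cite: PastenShimura2024, §18.1 Lemma 18.1 (proof)] -/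
theorem sum_faltingsArchTerm_lt [W.IsElliptic] :
    ∑ σ : K →+* ℂ, (W.map σ).faltingsArchTerm < 16 * (Module.finrank ℚ K : ℝ) := by
  have hS : ∑ σ : K →+* ℂ, (W.map σ).faltingsArchTerm < ∑ _σ : K →+* ℂ, (16 : ℝ) :=
    Finset.sum_lt_sum_of_nonempty Finset.univ_nonempty fun σ _ =>
      (W.map σ).faltingsArchTerm_lt_sixteen
  rwa [Finset.sum_const, Finset.card_univ, NumberField.Embeddings.card K ℂ, nsmul_eq_mul,
    mul_comm] at hS

end NumberField

/-- **Discharge of `log_minimalDiscriminantNorm_lt_faltingsHeight` (Pasten 2024, Lemma 18.1):**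
`[L:ℚ]⁻¹ · log N(𝔇_min(E/L)) < 12 h(E/L) + 16` for every elliptic curve over a number field `L`.
Proof as printed ("one deduces" it from Silverman's formula (EqSilvermanH)): by the closed formula
`12 h(E/L) = [L:ℚ]⁻¹ (log N(𝔇_min) − Σ_σ faltingsArchTerm (E ⊗_σ ℂ))` (`faltingsHeight`) the claim
is `[L:ℚ]⁻¹ Σ_σ faltingsArchTerm (E ⊗_σ ℂ) < 16`, which is `sum_faltingsArchTerm_lt`, each summand
being `log((2π)¹²|Δ(τ_σ)|Im(τ_σ)⁶) < 16`. (Dot-notation extension of Mathlib's `WeierstrassCurve`.)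
[cite: PastenShimura2024, §18.1 Lemma 18.1] -/
theorem log_minimalDiscriminantNorm_lt_faltingsHeight_holds :
    log_minimalDiscriminantNorm_lt_faltingsHeight := by
  intro L _ _ W _
  have hd : (0 : ℝ) < (Module.finrank ℚ L : ℝ) := by exact_mod_cast Module.finrank_pos
  have hS := W.sum_faltingsArchTerm_lt
  unfold faltingsHeight
  set d : ℝ := (Module.finrank ℚ L : ℝ) with hd_def
  set A : ℝ := Real.log (W.minimalDiscriminantNorm (𝓞 L)) with hA_def
  set S : ℝ := ∑ σ : L →+* ℂ, (W.map σ).faltingsArchTerm with hS_def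
  have h1 : d⁻¹ * S < 16 := by
    rw [inv_mul_eq_div, div_lt_iff₀ hd]
    linarith
  have h2 : 12 * ((12 * d)⁻¹ * (A - S)) = d⁻¹ * A - d⁻¹ * S := by
    field_simp
  rw [h2]
  linarith

end WeierstrassCurve

end
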